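import Summits.CriticalPhenomena.PercolationContinuityZ3.Theorems.PercNearOneGluingNoHeavyLowerTailSahiGridPatternZeroLocusIndep
import Summits.CriticalPhenomena.PercolationContinuityZ3.Theorems.PercNearOneGluingNoHeavyLowerTailSahiGridPatternTwoCylinders
import Summits.CriticalPhenomena.PercolationContinuityZ3.Theorems.PercNearOneGluingNoHeavyLowerTailSahiGridPatternOrthantFactor
import Summits.CriticalPhenomena.PercolationContinuityZ3.Theorems.PercNearOneGluingNoHeavyLowerTailSahiGridPatternOrthant

/-!
# `NoHeavyLowerTail` (crux stmt-CriticalPhenomena-4575), Sahi programme P1: **COMPLEMENT DUALITY OF THE PATTERN FUNCTIONAL** —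
# `sStarD A' B' C' + sStarD A B C = H(A,B) + H(A,C) + H(B,C)` for the reversed complements `A' = σ([3]^d ∖ A)`, every dimension

Support file (Sahi cell, seat `prim-sahi-p1`, generation 27; `--supports stmt-CriticalPhenomena-4575`).  Pure proofs, no definitions, no `sorry`,
standard axioms.

THE MATHEMATICS.  Let `σ` be any coordinatewise relabelling of the three values of `[3]^d` (`Equiv.piCongrRight τ`, `τ : Fin d → S₃`) and
`H(X,Y) = 2^d·#(X∩Y) − #{(x,y) ∈ X×Y totally distinct}` the coefficientwise-Harris slack.  For ARBITRARY finsets `A, B, C ⊆ [3]^d`: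
* `sStarD_image_piCongrRight` — `sStarD` is invariant under `σ` applied to all three slots (value-relabelling invariance of the tensor, `tcD_valuePerm`);
* `sStarD_sdiff_univ_left/mid/right` — complementing one slot: `S(⊤∖A,B,C) = S(⊤,B,C) − S(A,B,C)` (inclusion–exclusion in each slot);
* `sStarD_univ_left₂` — `S(A,⊤,⊤) = 0` in every slot arrangement; with `sStarD_univ_eq_harrisSlack` (`S(A,B,⊤) = H(A,B)`):
* **`sStarD_compl_add`** — `S(⊤∖A, ⊤∖B, ⊤∖C) + S(A,B,C) = H(A,B) + H(A,C) + H(B,C)`, and **`sStarD_dual_add`** — the same with the reversed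
  complements `σ(⊤∖A)` (which are UP-SETS when `A` is an up-set and `σ` reverses every axis: `isUpperSet_image_rev_sdiff`).
CONSEQUENCE (`patternPos_iff_le_harris`): `PatternPos d` is EQUIVALENT to the upper bound `sStarD A B C ≤ H(A,B)+H(A,C)+H(B,C)` for all up-sets —
the pattern-level form of `E₃(A,B,C) + E₃(Aᶜ,Bᶜ,Cᶜ) = Cov(A,B)+Cov(A,C)+Cov(B,C)`; so every LOWER bound proved for a family of first slots
(orthants, two-orthant unions, caterpillars, …) is at the same time an UPPER bound `S ≤ ΣH` for the dual family (clauses, …), and conversely.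
Nothing here asserts `PatternPos d` for `d ≥ 4`. [this work]
-/

namespace Summit.CriticalPhenomena.PercolationContinuityZ3.Theorems.SahiGridPattern

open Finset SahiGrid3
open scoped BigOperators

variable {d : ℕ}

/-! ### Value-relabelling invariance at the level of sets -/

/-- **`sStarD` is invariant under a coordinatewise relabelling of the values applied to all three slots.** [this work] -/
theorem sStarD_image_piCongrRight (τ : Fin d → Equiv.Perm (Fin 3)) (A B C : Finset (Pd d)) :
    sStarD (A.image (Equiv.piCongrRight τ)) (B.image (Equiv.piCongrRight τ)) (C.image (Equiv.piCongrRight τ)) = sStarD A B C := by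
  have hinj : Function.Injective (Equiv.piCongrRight τ : Pd d → Pd d) := (Equiv.piCongrRight τ).injective
  simp only [sStarD_eq_sum_tcD]
  rw [Finset.sum_image fun x _ y _ h => hinj h]
  refine Finset.sum_congr rfl fun p _ => ?_
  rw [Finset.sum_image fun x _ y _ h => hinj h]
  refine Finset.sum_congr rfl fun q _ => ?_
  rw [Finset.sum_image fun x _ y _ h => hinj h]
  refine Finset.sum_congr rfl fun r _ => ?_
  exact tcD_valuePerm τ p q r

/-! ### Complementing one slot -/

/-- `S(⊤∖A, B, C) = S(⊤,B,C) − S(A,B,C)`. [this work] -/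
theorem sStarD_sdiff_univ_left (A B C : Finset (Pd d)) :
    sStarD (univ \ A) B C = sStarD univ B C - sStarD A B C := by
  have h := sStarD_union_add_inter₁ A (univ \ A) B C
  rw [Finset.union_sdiff_of_subset (Finset.subset_univ A), Finset.inter_sdiff_self, sStarD_empty_left] at h
  linarith

/-- `S(A, ⊤∖B, C) = S(A,⊤,C) − S(A,B,C)`. [this work] -/
theorem sStarD_sdiff_univ_mid (A B C : Finset (Pd d)) :
    sStarD A (univ \ B) C = sStarD A univ C - sStarD A B C := by
  rw [sStarD_swap12 A (univ \ B), sStarD_sdiff_univ_left, sStarD_swap12 univ, sStarD_swap12 B]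

/-- `S(A, B, ⊤∖C) = S(A,B,⊤) − S(A,B,C)`. [this work] -/
theorem sStarD_sdiff_univ_right (A B C : Finset (Pd d)) :
    sStarD A B (univ \ C) = sStarD A B univ - sStarD A B C := by
  rw [sStarD_swap23 A B (univ \ C), sStarD_sdiff_univ_mid, sStarD_swap23 A univ, sStarD_swap23 A C]

/-- `S(A, ⊤, ⊤) = 0` (every `d`, any `A`). [this work] -/
theorem sStarD_univ_univ_right (A : Finset (Pd d)) : sStarD A univ univ = 0 := by
  rw [sStarD_univ_eq_harrisSlack]
  have hu : ∀ p : Pd d, ind (univ : Finset (Pd d)) p = 1 := fun p => by unfold ind; rw [if_pos (Finset.mem_univ p)]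
  simp only [hu, mul_one]
  have h : (∑ p : Pd d, ∑ q : Pd d, ind A p * (if TotDist p q = true then (1:ℤ) else 0)) = 2 ^ d * ∑ p : Pd d, ind A p := by
    rw [Finset.mul_sum]
    refine Finset.sum_congr rfl fun p _ => ?_
    rw [← Finset.mul_sum, sum_ite_totDist_eq_two_pow p]; ring
  rw [h]; ring

/-- `S(⊤, A, ⊤) = 0`. [this work] -/
theorem sStarD_univ_mid_univ (A : Finset (Pd d)) : sStarD univ A univ = 0 := by
  rw [sStarD_swap12, sStarD_univ_univ_right]

/-- `S(⊤, ⊤, A) = 0`. [this work] -/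
theorem sStarD_univ_univ_left (A : Finset (Pd d)) : sStarD univ univ A = 0 := by
  rw [sStarD_swap23, sStarD_swap12, sStarD_univ_univ_right]

/-- `S(A, ⊤, C) = H(A, C)`. [this work] -/
theorem sStarD_univ_mid_eq_harrisSlack (A C : Finset (Pd d)) :
    sStarD A univ C = 2 ^ d * (∑ p, ind A p * ind C p) - (∑ p, ∑ q, ind A p * ind C q * (if TotDist p q = true then (1:ℤ) else 0)) := by
  rw [sStarD_swap23, sStarD_univ_eq_harrisSlack]

/-- `S(⊤, B, C) = H(B, C)`. [this work] -/
theorem sStarD_univ_left_eq_harrisSlack (B C : Finset (Pd d)) :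
    sStarD univ B C = 2 ^ d * (∑ p, ind B p * ind C p) - (∑ p, ∑ q, ind B p * ind C q * (if TotDist p q = true then (1:ℤ) else 0)) := by
  rw [sStarD_swap12, sStarD_swap23, sStarD_univ_eq_harrisSlack]

/-! ### The duality identities -/

/-- **COMPLEMENT IDENTITY** (every `d`, arbitrary finsets): `S(⊤∖A, ⊤∖B, ⊤∖C) + S(A,B,C) = H(A,B) + H(A,C) + H(B,C)`. [this work] -/
theorem sStarD_compl_add (A B C : Finset (Pd d)) :
    sStarD (univ \ A) (univ \ B) (univ \ C) + sStarD A B C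
      = (2 ^ d * (∑ p, ind A p * ind B p) - (∑ p, ∑ q, ind A p * ind B q * (if TotDist p q = true then (1:ℤ) else 0)))
        + (2 ^ d * (∑ p, ind A p * ind C p) - (∑ p, ∑ q, ind A p * ind C q * (if TotDist p q = true then (1:ℤ) else 0)))
        + (2 ^ d * (∑ p, ind B p * ind C p) - (∑ p, ∑ q, ind B p * ind C q * (if TotDist p q = true then (1:ℤ) else 0))) := by
  rw [sStarD_sdiff_univ_left, sStarD_sdiff_univ_mid, sStarD_sdiff_univ_mid, sStarD_sdiff_univ_right, sStarD_sdiff_univ_right,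
    sStarD_sdiff_univ_right, sStarD_sdiff_univ_right, sStarD_univ_univ_univ, sStarD_univ_univ_left, sStarD_univ_mid_univ,
    sStarD_univ_univ_right, sStarD_univ_left_eq_harrisSlack, sStarD_univ_mid_eq_harrisSlack, sStarD_univ_eq_harrisSlack]
  ring

/-- **DUALITY** (every `d`): for any coordinatewise value relabelling `σ`, `S(σ(⊤∖A), σ(⊤∖B), σ(⊤∖C)) + S(A,B,C) = H(A,B)+H(A,C)+H(B,C)`. [this work] -/
theorem sStarD_dual_add (τ : Fin d → Equiv.Perm (Fin 3)) (A B C : Finset (Pd d)) :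
    sStarD ((univ \ A).image (Equiv.piCongrRight τ)) ((univ \ B).image (Equiv.piCongrRight τ)) ((univ \ C).image (Equiv.piCongrRight τ))
        + sStarD A B C
      = (2 ^ d * (∑ p, ind A p * ind B p) - (∑ p, ∑ q, ind A p * ind B q * (if TotDist p q = true then (1:ℤ) else 0)))
        + (2 ^ d * (∑ p, ind A p * ind C p) - (∑ p, ∑ q, ind A p * ind C q * (if TotDist p q = true then (1:ℤ) else 0)))
        + (2 ^ d * (∑ p, ind B p * ind C p) - (∑ p, ∑ q, ind B p * ind C q * (if TotDist p q = true then (1:ℤ) else 0))) := by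
  rw [sStarD_image_piCongrRight, sStarD_compl_add]

/-! ### The reversed complement of an up-set is an up-set -/

/-- The reversed complement `σ(⊤∖A)` of an up-set (`σ` = order reversal in every axis) is an up-set. [this work] -/
theorem isUpperSet_image_rev_sdiff {A : Finset (Pd d)} (hA : IsUpperSet (A : Set (Pd d))) :
    IsUpperSet ((((univ : Finset (Pd d)) \ A).image (Equiv.piCongrRight fun _ : Fin d => Fin.revPerm)) : Set (Pd d)) := by
  intro x y hxy hx
  rw [Finset.mem_coe, Finset.mem_image] at hx ⊢
  obtain ⟨p, hp, rfl⟩ := hx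
  rw [Finset.mem_sdiff] at hp
  have hinv : ∀ z : Pd d, (Equiv.piCongrRight fun _ : Fin d => Fin.revPerm) ((Equiv.piCongrRight fun _ : Fin d => Fin.revPerm) z) = z := by
    intro z; funext a; simp only [Equiv.piCongrRight_apply, Pi.map_apply, Fin.revPerm_apply, Fin.rev_rev]
  refine ⟨(Equiv.piCongrRight fun _ : Fin d => Fin.revPerm) y, ?_, hinv y⟩
  rw [Finset.mem_sdiff]
  refine ⟨Finset.mem_univ _, fun hy => hp.2 ?_⟩
  have hle : (Equiv.piCongrRight fun _ : Fin d => Fin.revPerm) y ≤ p := by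
    intro a
    have ha := hxy a
    simp only [Equiv.piCongrRight_apply, Pi.map_apply, Fin.revPerm_apply] at ha ⊢
    have h2 : (y a).rev ≤ ((p a).rev).rev := Fin.rev_le_rev.mpr ha
    rwa [Fin.rev_rev] at h2
  exact Finset.mem_coe.1 (hA hle (Finset.mem_coe.2 hy))

/-- `σ(⊤ ∖ σ(⊤∖A)) = A` for the involution `σ` = reversal in every axis. [this work] -/
theorem image_rev_sdiff_image_rev_sdiff (A : Finset (Pd d)) :
    ((univ : Finset (Pd d)) \ ((univ \ A).image (Equiv.piCongrRight fun _ : Fin d => Fin.revPerm))).image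
        (Equiv.piCongrRight fun _ : Fin d => Fin.revPerm) = A := by
  ext x
  have hinv : ∀ y : Pd d, (Equiv.piCongrRight fun _ : Fin d => Fin.revPerm) ((Equiv.piCongrRight fun _ : Fin d => Fin.revPerm) y) = y := by
    intro y; funext a; simp only [Equiv.piCongrRight_apply, Pi.map_apply, Fin.revPerm_apply, Fin.rev_rev]
  constructor
  · intro hx
    rw [Finset.mem_image] at hx
    obtain ⟨p, hp, rfl⟩ := hx
    rw [Finset.mem_sdiff] at hp
    by_contra hxA
    apply hp.2
    rw [Finset.mem_image]
    refine ⟨(Equiv.piCongrRight fun _ : Fin d => Fin.revPerm) p, ?_, hinv p⟩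
    rw [Finset.mem_sdiff]
    exact ⟨Finset.mem_univ _, hxA⟩
  · intro hx
    rw [Finset.mem_image]
    refine ⟨(Equiv.piCongrRight fun _ : Fin d => Fin.revPerm) x, ?_, hinv x⟩
    rw [Finset.mem_sdiff]
    refine ⟨Finset.mem_univ _, fun h => ?_⟩
    rw [Finset.mem_image] at h
    obtain ⟨p, hp, hpx⟩ := h
    rw [Finset.mem_sdiff] at hp
    have : p = x := by
      have := congrArg (Equiv.piCongrRight fun _ : Fin d => Fin.revPerm) hpx
      rw [hinv, hinv] at this
      exact this
    exact hp.2 (this ▸ hx)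

/-! ### `PatternPos d` as an upper bound -/

/-- **`PatternPos d` ⟺ `S(A,B,C) ≤ H(A,B) + H(A,C) + H(B,C)` for all up-sets** (every `d`). [this work] -/
theorem patternPos_iff_le_harris :
    PatternPos d ↔ ∀ A B C : Finset (Pd d), IsUpperSet (A : Set (Pd d)) → IsUpperSet (B : Set (Pd d)) → IsUpperSet (C : Set (Pd d)) →
      sStarD A B C ≤
        (2 ^ d * (∑ p, ind A p * ind B p) - (∑ p, ∑ q, ind A p * ind B q * (if TotDist p q = true then (1:ℤ) else 0)))
        + (2 ^ d * (∑ p, ind A p * ind C p) - (∑ p, ∑ q, ind A p * ind C q * (if TotDist p q = true then (1:ℤ) else 0)))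
        + (2 ^ d * (∑ p, ind B p * ind C p) - (∑ p, ∑ q, ind B p * ind C q * (if TotDist p q = true then (1:ℤ) else 0))) := by
  constructor
  · intro hP A B C hA hB hC
    have hid := sStarD_dual_add (fun _ : Fin d => Fin.revPerm) A B C
    have hnn := hP _ _ _ (isUpperSet_image_rev_sdiff hA) (isUpperSet_image_rev_sdiff hB) (isUpperSet_image_rev_sdiff hC)
    linarith
  · intro hU A B C hA hB hC
    have hid := sStarD_dual_add (fun _ : Fin d => Fin.revPerm)
      ((univ \ A).image (Equiv.piCongrRight fun _ : Fin d => Fin.revPerm))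
      ((univ \ B).image (Equiv.piCongrRight fun _ : Fin d => Fin.revPerm))
      ((univ \ C).image (Equiv.piCongrRight fun _ : Fin d => Fin.revPerm))
    rw [image_rev_sdiff_image_rev_sdiff, image_rev_sdiff_image_rev_sdiff, image_rev_sdiff_image_rev_sdiff] at hid
    have hle := hU _ _ _ (isUpperSet_image_rev_sdiff hA) (isUpperSet_image_rev_sdiff hB) (isUpperSet_image_rev_sdiff hC)
    -- `hle` bounds `S(A',B',C')` by `ΣH(A',B')`, and `hid` reads `S(A,B,C) + S(A',B',C') = ΣH(A',B')`
    linarith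

/-! ### Consequences: upper bounds by duality (appended, generation 27) -/

/-- **Upper bound from a good dual**: if the reversed complement `σ(⊤∖A)` is a good first slot (nonnegative pattern functional against all up-sets),
then `sStarD A B C ≤ H(A,B) + H(A,C) + H(B,C)` for all up-sets `B, C`. [this work] -/
theorem sStarD_le_harris_of_dual_good {A : Finset (Pd d)}
    (hgood : ∀ P Q : Finset (Pd d), IsUpperSet (P : Set (Pd d)) → IsUpperSet (Q : Set (Pd d)) →
      0 ≤ sStarD ((univ \ A).image (Equiv.piCongrRight fun _ : Fin d => Fin.revPerm)) P Q)
    (B C : Finset (Pd d)) (hB : IsUpperSet (B : Set (Pd d))) (hC : IsUpperSet (C : Set (Pd d))) :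
    sStarD A B C ≤
      (2 ^ d * (∑ p, ind A p * ind B p) - (∑ p, ∑ q, ind A p * ind B q * (if TotDist p q = true then (1:ℤ) else 0)))
        + (2 ^ d * (∑ p, ind A p * ind C p) - (∑ p, ∑ q, ind A p * ind C q * (if TotDist p q = true then (1:ℤ) else 0)))
        + (2 ^ d * (∑ p, ind B p * ind C p) - (∑ p, ∑ q, ind B p * ind C q * (if TotDist p q = true then (1:ℤ) else 0))) := by
  have hid := sStarD_dual_add (fun _ : Fin d => Fin.revPerm) A B C
  have hnn := hgood _ _ (isUpperSet_image_rev_sdiff hB) (isUpperSet_image_rev_sdiff hC)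
  linarith

/-- The reversed complement of the reversed complement of the orthant `↑q` is `↑q`. [this work] -/
theorem image_rev_sdiff_dualOrthant (q : Pd d) :
    ((univ : Finset (Pd d)) \ (((univ : Finset (Pd d)) \ (univ.filter fun x : Pd d => ∀ a, q a ≤ x a)).image
        (Equiv.piCongrRight fun _ : Fin d => Fin.revPerm))).image (Equiv.piCongrRight fun _ : Fin d => Fin.revPerm)
      = univ.filter fun x : Pd d => ∀ a, q a ≤ x a :=
  image_rev_sdiff_image_rev_sdiff _

/-- **CLAUSE UPPER BOUND** (every `d`; dual of the orthant theorem `sStarD_principal_nonneg`): the reversed complement `K = σ(⊤ ∖ ↑q)` of an orthant —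
i.e. the CLAUSE pattern `{x : ∃ a, 3 − q a ≤ x a}` — satisfies `sStarD K B C ≤ H(K,B) + H(K,C) + H(B,C)` for all up-sets `B, C`. [this work] -/
theorem sStarD_dualOrthant_le_harris (q : Pd d) (B C : Finset (Pd d)) (hB : IsUpperSet (B : Set (Pd d))) (hC : IsUpperSet (C : Set (Pd d))) :
    sStarD (((univ : Finset (Pd d)) \ (univ.filter fun x : Pd d => ∀ a, q a ≤ x a)).image (Equiv.piCongrRight fun _ : Fin d => Fin.revPerm)) B C ≤
      (2 ^ d * (∑ p, ind (((univ : Finset (Pd d)) \ (univ.filter fun x : Pd d => ∀ a, q a ≤ x a)).image (Equiv.piCongrRight fun _ : Fin d => Fin.revPerm)) p * ind B p)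
          - (∑ p, ∑ q', ind (((univ : Finset (Pd d)) \ (univ.filter fun x : Pd d => ∀ a, q a ≤ x a)).image (Equiv.piCongrRight fun _ : Fin d => Fin.revPerm)) p
              * ind B q' * (if TotDist p q' = true then (1:ℤ) else 0)))
        + (2 ^ d * (∑ p, ind (((univ : Finset (Pd d)) \ (univ.filter fun x : Pd d => ∀ a, q a ≤ x a)).image (Equiv.piCongrRight fun _ : Fin d => Fin.revPerm)) p * ind C p)
          - (∑ p, ∑ q', ind (((univ : Finset (Pd d)) \ (univ.filter fun x : Pd d => ∀ a, q a ≤ x a)).image (Equiv.piCongrRight fun _ : Fin d => Fin.revPerm)) p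
              * ind C q' * (if TotDist p q' = true then (1:ℤ) else 0)))
        + (2 ^ d * (∑ p, ind B p * ind C p) - (∑ p, ∑ q', ind B p * ind C q' * (if TotDist p q' = true then (1:ℤ) else 0))) := by
  refine sStarD_le_harris_of_dual_good (fun P Q hP hQ => ?_) B C hB hC
  rw [image_rev_sdiff_dualOrthant]
  exact sStarD_principal_nonneg d q P Q hP hQ

end Summit.CriticalPhenomena.PercolationContinuityZ3.Theorems.SahiGridPattern
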